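import Literature.NumberTheory.Sieve.SmoothRestrictionWellSpaced
import HarnessLib

/-!
# Restriction for smooth numbers, IV: shifted and oversampled grids

Topic `Literature/NumberTheory/Sieve`; a PROVED file. Harper's discrete `L^{5/2}` restriction
estimate for the exponential sum `S(θ) = ∑_{n ≤ x, n ∈ S(y)} a_n e(nθ)` (`|a_n| ≤ 1`) over friable
numbers ([Harper2016, Theorem 2], discrete form), on the grid `θ₀ + k/N₀`, `0 ≤ k < N₀`, with an
ARBITRARY shift `θ₀` and an ARBITRARY number `N₀ ≥ 1` of sample points, paid by the factor `1 + N₀/x`: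

`discreteRestriction_five_halves_oversampled`:
`∑_{k<N₀} |S(θ₀ + k/N₀)|^{5/2} ≤ C (log x)¹⁹ (1 + N₀/x) 𝓟^{5/2}`, `𝓟 = x^α ζ(α,y)/√φ₂(α,y)`,

under the side conditions of the tree's `discreteRestriction_five_halves` (the case `θ₀ = 0`,
`N₀ ≤ x`). It is a corollary of the well-spaced form
`discreteRestriction_five_halves_wellSpaced` (SmoothRestrictionWellSpaced.lean): with
`m = ⌊N₀/x⌋ + 1` (so `m/N₀ ≥ 1/x`), the indices `k < N₀ − m` split into `m` residue classes mod `m`,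
each of which gives points `θ₀ + k/N₀` that are `1/x`-spaced modulo one
(`residueClass_wellSpaced`: two such indices differ by a nonzero multiple `D` of `m` with
`|D| ≤ N₀ − m`, whence `|D − ℓN₀| ≥ m` for all `ℓ ∈ ℤ`), and the last `m` indices are taken one at a
time; in all `2m ≤ 2(1 + N₀/x)` well-spaced families.

## References

* A. J. Harper, *Minor arcs, mean values, and restriction theory for exponential sums over smooth
  numbers*, Compositio Math. 152 (2016) 1121–1158, Theorem 2 and §4, p. 18 [Harper2016].
-/

noncomputable section

open Finset Real
open scoped FourierTransform

namespace Literature.NumberTheory.Sieve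

/-! ### Residue classes of an oversampled grid are well spaced -/

/-- **Integer core of the spacing of residue classes.** If `m ∣ D`, `D ≠ 0` and `|D| + m ≤ N₀`,
then `m ≤ |D − ℓ N₀|` for every integer `ℓ`. [folklore] -/
theorem le_abs_sub_mul_of_dvd {m N₀ D : ℤ} (hm : 0 < m) (hdvd : m ∣ D) (hD : D ≠ 0)
    (hDN : |D| + m ≤ N₀) (ℓ : ℤ) : m ≤ |D - ℓ * N₀| := by
  have hmD : m ≤ |D| := by
    by_contra h
    push Not at h
    exact hD (Int.eq_zero_of_abs_lt_dvd hdvd h)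
  have hN₀ : 0 ≤ N₀ := by linarith [abs_nonneg D]
  rcases lt_trichotomy ℓ 0 with hℓ | rfl | hℓ
  · -- `ℓ ≤ -1`: `D - ℓ N₀ ≥ -|D| + N₀ ≥ m`
    have h1 : ℓ * N₀ ≤ -N₀ := by
      have := mul_le_mul_of_nonneg_right (show ℓ ≤ -1 by omega) hN₀; linarith
    have h2 : -|D| ≤ D := neg_abs_le D
    exact le_abs.mpr (Or.inl (by linarith))
  · simpa using hmD
  · -- `ℓ ≥ 1`: `D - ℓ N₀ ≤ |D| - N₀ ≤ -m`
    have h1 : N₀ ≤ ℓ * N₀ := by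
      have := mul_le_mul_of_nonneg_right (show 1 ≤ ℓ by omega) hN₀; linarith
    have h2 : D ≤ |D| := le_abs_self D
    exact le_abs.mpr (Or.inr (by linarith))

/-- **Residue classes of the grid `θ₀ + k/N₀` are `1/x`-spaced.** If `N₀ ≤ m x` and
`M + m ≤ N₀`, then for `k ≠ k'` in `[0, M)` with `k ≡ k' (mod m)` the points `θ₀ + k/N₀`,
`θ₀ + k'/N₀` are at distance `≥ 1/x` modulo one. [folklore] -/
theorem residueClass_wellSpaced {x θ₀ : ℝ} {N₀ m M : ℕ} (hx : 0 < x) (hm : 0 < m)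
    (hmx : (N₀ : ℝ) ≤ m * x) (hM : M + m ≤ N₀) (r : ℕ) :
    ∀ i ∈ (Finset.range M).filter (fun k => k % m = r),
      ∀ j ∈ (Finset.range M).filter (fun k => k % m = r), i ≠ j → ∀ ℓ : ℤ,
        1 / x ≤ |(θ₀ + (j : ℝ) / N₀) - (θ₀ + (i : ℝ) / N₀) - ℓ| := by
  intro i hi j hj hij ℓ
  rw [Finset.mem_filter, Finset.mem_range] at hi hj
  have hN₀ : 0 < N₀ := by omega
  have hN₀r : (0 : ℝ) < N₀ := by exact_mod_cast hN₀
  -- the integer `D = j - i`: a nonzero multiple of `m` with `|D| + m ≤ N₀`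
  have hmod : i ≡ j [MOD m] := by show i % m = j % m; rw [hi.2, hj.2]
  have hdvd : (m : ℤ) ∣ (j : ℤ) - i := hmod.dvd
  have hD0 : (j : ℤ) - i ≠ 0 := fun h => hij (by omega)
  have habs : |(j : ℤ) - i| ≤ (M : ℤ) - 1 := abs_le.mpr ⟨by omega, by omega⟩
  have hDN : |(j : ℤ) - i| + m ≤ N₀ := by
    have : (M : ℤ) + m ≤ N₀ := by exact_mod_cast hM
    linarith
  have key := le_abs_sub_mul_of_dvd (by exact_mod_cast hm) hdvd hD0 hDN ℓ
  -- the real side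
  have hexpr : (θ₀ + (j : ℝ) / N₀) - (θ₀ + (i : ℝ) / N₀) - ℓ =
      (((j : ℤ) - i - ℓ * N₀ : ℤ) : ℝ) / N₀ := by
    push_cast; field_simp; ring
  rw [hexpr, abs_div, abs_of_pos hN₀r]
  have hkey : (m : ℝ) ≤ |(((j : ℤ) - i - ℓ * N₀ : ℤ) : ℝ)| := by
    rw [← Int.cast_abs]; exact_mod_cast key
  calc 1 / x ≤ (m : ℝ) / N₀ := by
        rw [div_le_div_iff₀ hx hN₀r, one_mul]; exact hmx
    _ ≤ _ := div_le_div_of_nonneg_right hkey hN₀r.le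

/-! ### The shifted and oversampled restriction estimate -/

/-- **Discrete `L^{5/2}` restriction for smooth numbers on a shifted, oversampled grid** (Harper,
Theorem 2, discrete form with `p = 5/2`): for every `N₀ ≥ 1`, every shift `θ₀` and `|a_n| ≤ 1`,
`∑_{k<N₀} |∑_{n ≤ x, n ∈ S(y)} a_n e(n(θ₀ + k/N₀))|^{5/2} ≤ C (log x)¹⁹ (1 + N₀/x) 𝓟^{5/2}`,
`𝓟 = x^α ζ(α,y)/√φ₂(α,y)`. Reduction to `discreteRestriction_five_halves_wellSpaced`: with
`m = ⌊N₀/x⌋ + 1` the residue classes mod `m` of `[0, N₀ − m)` and the `m` remaining single points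
are `2m ≤ 2(1 + N₀/x)` families of `1/x`-spaced points. [cite: Harper2016, Theorem 2 and §4, p. 18] -/
theorem discreteRestriction_five_halves_oversampled :
    ∃ C x₀ : ℝ, 0 < C ∧ ∀ (x : ℝ) (y : ℕ), x₀ ≤ x → Real.log x ^ 8 ≤ (y : ℝ) →
      Real.log (y : ℝ) ≤ 1 / 2 * Real.log x ^ (1 / 6 : ℝ) → (y : ℝ) ^ 200 ≤ x →
      1 - 1 / 10000 ≤ saddlePoint x y →
      x ^ ((39999 : ℝ) / 40000) ≤ ((Nat.smoothNumbersUpTo ⌊x⌋₊ (y + 1)).card : ℝ) →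
      ∀ (N₀ : ℕ), 1 ≤ N₀ → ∀ (θ₀ : ℝ) (a : ℕ → ℂ), (∀ n, ‖a n‖ ≤ 1) →
        ∑ k ∈ Finset.range N₀,
            ‖∑ n ∈ Nat.smoothNumbersUpTo ⌊x⌋₊ (y + 1), a n * (𝐞 ((n : ℝ) * (θ₀ + (k : ℝ) / N₀)) : ℂ)‖ ^
              ((5 : ℝ) / 2) ≤
          C * Real.log x ^ (19 : ℕ) * (1 + (N₀ : ℝ) / x) *
            (x ^ saddlePoint x y *
              (smoothZeta (saddlePoint x y) y / Real.sqrt (saddlePhi₂ (saddlePoint x y) y))) ^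
                ((5 : ℝ) / 2) := by
  classical
  obtain ⟨C, x₀, hC, hW⟩ := discreteRestriction_five_halves_wellSpaced
  refine ⟨2 * C, max x₀ 2, by positivity, fun x y hx hy8 hy6 hy200 hα hΨ N₀ hN₀ θ₀ a ha => ?_⟩
  have hx₀ : x₀ ≤ x := le_trans (le_max_left _ _) hx
  have hx2 : (2 : ℝ) ≤ x := le_trans (le_max_right _ _) hx
  have hx0 : 0 < x := by linarith
  have hN₀r : (0 : ℝ) < N₀ := by exact_mod_cast hN₀
  set S := Nat.smoothNumbersUpTo ⌊x⌋₊ (y + 1) with hS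
  set P : ℝ := (x ^ saddlePoint x y *
    (smoothZeta (saddlePoint x y) y / Real.sqrt (saddlePhi₂ (saddlePoint x y) y))) ^ ((5 : ℝ) / 2) with hP
  set B : ℝ := C * Real.log x ^ (19 : ℕ) * P with hB
  set f : ℕ → ℝ := fun k => ‖∑ n ∈ S, a n * (𝐞 ((n : ℝ) * (θ₀ + (k : ℝ) / N₀)) : ℂ)‖ ^ ((5 : ℝ) / 2)
    with hf
  -- the well-spaced bound for sub-families of the grid `θ₀ + k/N₀`
  have hT : ∀ T : Finset ℕ, (∀ i ∈ T, ∀ j ∈ T, i ≠ j → ∀ ℓ : ℤ,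
      1 / x ≤ |(θ₀ + (j : ℝ) / N₀) - (θ₀ + (i : ℝ) / N₀) - ℓ|) → ∑ k ∈ T, f k ≤ B :=
    fun T hsp => hW x y hx₀ hy8 hy6 hy200 hα hΨ T (fun k : ℕ => θ₀ + (k : ℝ) / N₀) hsp a ha
  have hsingle : ∀ k, f k ≤ B := by
    intro k
    have h := hT {k} (fun i hi j hj hij =>
      absurd ((Finset.mem_singleton.mp hi).trans (Finset.mem_singleton.mp hj).symm) hij)
    rwa [Finset.sum_singleton] at h
  have hB0 : 0 ≤ B := by
    have h := hT ∅ (fun i hi => by simp at hi)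
    rwa [Finset.sum_empty] at h
  -- the modulus `m = ⌊N₀/x⌋ + 1`: `N₀ ≤ m x`, `m ≤ N₀/x + 1`, `m ≤ N₀`
  set m : ℕ := ⌊(N₀ : ℝ) / x⌋₊ + 1 with hm
  have hm0 : 0 < m := Nat.succ_pos _
  have hmx : (N₀ : ℝ) ≤ m * x := by
    have h1 : (N₀ : ℝ) / x < m := by rw [hm]; push_cast; exact Nat.lt_floor_add_one _
    rw [div_lt_iff₀ hx0] at h1; exact h1.le
  have hmle : (m : ℝ) ≤ N₀ / x + 1 := by
    rw [hm]; push_cast; linarith [Nat.floor_le (show (0 : ℝ) ≤ N₀ / x by positivity)]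
  have hmN : m ≤ N₀ := by
    have h1 : (N₀ : ℝ) / x < N₀ := by rw [div_lt_iff₀ hx0]; nlinarith
    have h2 : ⌊(N₀ : ℝ) / x⌋₊ < N₀ := (Nat.floor_lt (by positivity)).mpr h1
    omega
  obtain ⟨M, hMdef⟩ : ∃ M : ℕ, N₀ = M + m := ⟨N₀ - m, by omega⟩
  have hMm : M + m ≤ N₀ := by omega
  -- first block `[0, M)`: `m` residue classes, each `1/x`-spaced
  have hfirst : ∑ k ∈ Finset.range M, f k ≤ m * B := by
    rw [← Finset.sum_fiberwise_of_maps_to (s := Finset.range M) (t := Finset.range m)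
      (g := fun k => k % m) (fun k _ => Finset.mem_range.mpr (Nat.mod_lt _ hm0)) f]
    calc ∑ r ∈ Finset.range m, ∑ k ∈ (Finset.range M).filter (fun k => k % m = r), f k
        ≤ ∑ r ∈ Finset.range m, B :=
          Finset.sum_le_sum fun r _ => hT _ (residueClass_wellSpaced hx0 hm0 hmx hMm r)
      _ = m * B := by simp
  -- second block `[M, N₀)`: `m` single points
  have hsecond : ∑ k ∈ Finset.range m, f (M + k) ≤ m * B := by
    calc ∑ k ∈ Finset.range m, f (M + k) ≤ ∑ k ∈ Finset.range m, B :=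
          Finset.sum_le_sum fun k _ => hsingle _
      _ = m * B := by simp
  have hsum : ∑ k ∈ Finset.range N₀, f k ≤ 2 * m * B := by
    rw [hMdef, Finset.sum_range_add]; linarith
  calc ∑ k ∈ Finset.range N₀, f k ≤ 2 * m * B := hsum
    _ ≤ 2 * ((N₀ : ℝ) / x + 1) * B := by gcongr
    _ = 2 * C * Real.log x ^ (19 : ℕ) * (1 + (N₀ : ℝ) / x) * P := by rw [hB]; ring

end Literature.NumberTheory.Sieve

end
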